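import Summits.QuantumFields.YangMills.Theorems.AllWindowsColdBoxBoxHighLineRarityBootstrap
import Summits.QuantumFields.YangMills.Theorems.AllWindowsColdBoxBoxHighLineLandauRepresentativeStrong
import Summits.QuantumFields.YangMills.Theorems.AllWindowsColdBoxBoxHighLineOrbitJacobianFinalSup

/-!
# The rarity bootstrap at the U5 window: w5's ✓`BoxToChart.boxState_not_smallPlaquettes_bootstrap` with (i) = ✓U2 and (ii) = ✓T-S5.4J∞
# (`C·H⁸(1+log β)⁵ ≤ β`, precision `β^{−p}`, gap `2H²(1+log β)²/√β`, cut-off `C·r·H² ≤ 1`)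

Width seat `ym-line-sfw-p2-w2` (prover-ym-line-sfw-p2-w2-g32-0).  Planner ym-idea-2 g18's `ASSEMBLY-U5.md` v0 §1 (E1)/§5 Q4: «decide crude-vs-bootstrapped rarity in
Step A (bootstrapped is strictly better and landed; use it)»; but w5 g23's landed window wrappers ✓`boxState_not_smallPlaquettes_bootstrap_window_strong(')`
call ✓`orbitNormaliserJacobianR` (window `C·H¹²(1+log β)⁸ ≤ β`, i.e. `12θ < 1`), which is void on U5's window.  This file re-runs the wrapper with
✓`OrbitJacobian.orbitNormaliserJacobian_sup p` (L1∞, `8θ < 1`) and ✓U2 `stub_landauRepresentativeStrong`, exactly as ✓`fpRepresentation_window_sup` /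
✓`BoxToChart.boxPlaqCov_sub_chartCov_le_window_sup` (`…BoxToChartReductionWindowSup`):

* ★★ `BoxToChart.boxState_not_smallPlaquettes_bootstrap_window_sup (p)` — in the window `C·H⁸(1+log β)⁵ ≤ β`, `(β^p)⁻¹ ≤ 1/2`, `spl·H³(1+log H) ≤ c₀`,
  `C r₀ H² ≤ 1` (`r₀ = K·H·(1+log H)·spl`), `r₀ + 2H²(1+log β)²/√β ≤ r`, `C r H² ≤ 1`, `0 ≤ s ≤ 1/100`, `17s² ≤ spl²`, `17s² ≤ spl′²`, `hτ`:
  `P_box(¬SP(spl′)) ≤ 4β^{−p} + 4·P_box(¬SP(spl)) + 2τ`.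

The iterable β-letter step at the U5 window (w5's ✓`rarity_bootstrap_step` with the discharges of ✓`BoxToChart.boxPlaqCov_sub_chartCov_relative_sup`) is NOT
here.  Everything proved; no definitions; tree only; standard axioms.  HONEST LABEL: plumbing (U5 prep, helper, «optional-but-better» per the planner); U5,
⟨stmt-QuantumFields-24336⟩, ⟨24004⟩ remain OPEN; no stub is closed by name; no crux, rung or summit is proved; **the Yang–Mills mass gap is NOT proved by this
file; no summit is proved by a line.**
-/

set_option autoImplicit false

noncomputable section

open MeasureTheory
open Literature.Probability.LatticeModels (Site)
open Literature.MathematicalPhysics.QuantumFieldTheory.AxialGauge (boxEdges)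
open Literature.MathematicalPhysics.QuantumLattice (LGConfig gaugeTransformZd fundamentalRep)
open Summit.QuantumFields.YangMills.Theorems.WeakCouplingRates (boxState)

namespace Summit.QuantumFields.YangMills.Theorems.AllWindowsColdBoxBoxHighLine

namespace BoxToChart

/-- ★★ **Rarity bootstrap at the U5 window** ((i) = ✓U2 `stub_landauRepresentativeStrong`, (ii) = ✓T-S5.4J∞ `OrbitJacobian.orbitNormaliserJacobian_sup p`,
`δ = β^{−p}`): `P_box(¬SP(spl′)) ≤ 4β^{−p} + 4·P_box(¬SP(spl)) + 2τ`. [folklore] -/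
theorem boxState_not_smallPlaquettes_bootstrap_window_sup (p : ℕ) :
    ∃ K C c₀ : ℝ, 0 < K ∧ 0 < C ∧ 0 < c₀ ∧ ∀ H : ℕ, 1 ≤ H → ∀ (β spl spl' r s τ : ℝ), 2 ≤ β →
      C * (H : ℝ) ^ 8 * (1 + Real.log β) ^ 5 ≤ β → (β ^ p)⁻¹ ≤ 1 / 2 →
      0 ≤ spl → spl * (H : ℝ) ^ 3 * (1 + Real.log H) ≤ c₀ →
      C * (K * H * (1 + Real.log H) * spl) * (H : ℝ) ^ 2 ≤ 1 →
      K * H * (1 + Real.log H) * spl + 2 * ((H : ℝ) ^ 2 * (1 + Real.log β) ^ 2 / Real.sqrt β) ≤ r → C * r * (H : ℝ) ^ 2 ≤ 1 →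
      0 ≤ s → s ≤ 1 / 100 → 17 * s ^ 2 ≤ spl ^ 2 → 17 * s ^ 2 ≤ spl' ^ 2 → 0 ≤ τ →
      (∫ a in chartDomain H \ smallField H s, fpChartWeight β H r a ≤ τ * ∫ a in smallField H (s / 2), fpChartWeight β H r a) →
      ((boxState (fundamentalRep (Fin 2)) β H) {U | ¬ SmallPlaquettes H spl' U}).toReal ≤
        4 * (β ^ p)⁻¹ + 4 * ((boxState (fundamentalRep (Fin 2)) β H) {U | ¬ SmallPlaquettes H spl U}).toReal + 2 * τ := by
  obtain ⟨C₂, c₀, hC₂, hc₀, h2⟩ := stub_landauRepresentativeStrong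
  obtain ⟨C, hC, hR⟩ := OrbitJacobian.orbitNormaliserJacobian_sup p
  refine ⟨Real.sqrt C₂, C, c₀, Real.sqrt_pos.2 hC₂, hC, hc₀, ?_⟩
  intro H hH β spl spl' r s τ hβ hwin hδ hspl hprem hr₀C hgap hrC hs0 hs1 hspls hspls' hτ0 hτ
  set r₀ : ℝ := Real.sqrt C₂ * H * (1 + Real.log H) * spl with hr₀
  have hHr : (1 : ℝ) ≤ (H : ℝ) := by exact_mod_cast hH
  have hlogH : 0 ≤ 1 + Real.log (H : ℝ) := by linarith [Real.log_nonneg hHr]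
  have hr₀0 : 0 ≤ r₀ := by rw [hr₀]; positivity
  have hr₀sq : r₀ ^ 2 = C₂ * (H : ℝ) ^ 2 * (1 + Real.log H) ^ 2 * spl ^ 2 := by
    rw [hr₀]
    have := Real.sq_sqrt hC₂.le
    ring_nf
    rw [this]
    ring
  have hβ0 : 0 < β := by linarith
  refine boxState_not_smallPlaquettes_bootstrap hH (r₀ := r₀) hβ0 (by positivity) hδ ?_ ?_ hs0 hs1 hspls hspls' hτ0 hτ
  · -- (i) the strong Landau representative from U2
    intro U hU hsp
    obtain ⟨g, hg, hL, hlinks⟩ := h2 H hH spl hspl hprem U hU hsp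
    exact ⟨g, hg, hL, fun e he => (hlinks e he).trans_eq hr₀sq.symm⟩
  · -- (ii) the orbit-normaliser precision from T-S5.4J∞
    intro V hV hlinks
    exact hR H hH β r₀ r hβ hwin hr₀0 hr₀C hgap hrC V hV hlinks

end BoxToChart

end Summit.QuantumFields.YangMills.Theorems.AllWindowsColdBoxBoxHighLine

end
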